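import Literature.MathematicalPhysics.QuantumFieldTheory.Balaban1983to89.B9Eq3120DeltaPiPrimeFormDiagonal
import Literature.MathematicalPhysics.QuantumFieldTheory.Balaban1983to89.B9Eq325GaugeModeLetterDiagonal
import Literature.MathematicalPhysics.QuantumFieldTheory.Balaban1983to89.B9Eq3119DeltaPiTower

/-!
# `Balaban1983to89.B9Eq3120DeltaPiPrimeFormDiagonalClosed` — T. Bałaban, *Propagators for lattice gauge theories in a background field*, Commun. Math.
# Phys. **99** (1985) 389–434 [Balaban1985BackgroundPropagators] (3.119)–(3.120) p. 419, (3.122) p. 420, (3.36) p. 396, Thm 3.11 p. 416: **THE θ-LETTER OF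
# THE `Δ_π` PORT WITH THE λ-LETTERS INHABITED — `‖⟨u, (π_k†Δ^η(U)π_k)v⟩ − ⟨u, Δ^η(U)v⟩‖ ≤ θ·α·N₁(u)·N₁(v)` ON PRINT's DIAGONAL WITH ONE `∃ α₀ θ` BEFORE
# EVERY BINDER, AT `G′ := G′_k = (Δ′_{a′,k}(U))⁻¹`** — the closing corollary of the row OWNER t4-ne9-p1 g87's `B9Eq3120DeltaPiPrimeFormDiagonal`
# (step (ii) of `DELTA-PI-PROGRAMME.md`) on this lineage's `B9Eq325GaugeModeLetterDiagonal`

statement-level skeleton of published theorems with citation tags; proofs where landed; nothing here is a claim about the Yang–Mills mass gap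

PDF held: `paper:balaban1985-cmp99-background-propagators` (journal page = PDF page + 388), pp. 396, 416, 419–420 — through the verbatim quotations of
`B9Eq3120DeltaPiPrimeFormDiagonal` (p. 419 L30–31 «The quadratic form Δ′π is a small perturbation of Δ. Later we will write bounds for this form»),
`B9Eq3119DeltaPiTower` ((3.119) `π = 1 − DG′RD*`, (3.122) `Δ̃_{a,k}(U)`), `B9Eq325GaugeModeLetterDiagonal` (Thm 3.11's class).

CITATION HEADER (lean-in-tree rule).  Audit cell `pub-balaban`, sub-cell `t4`, BINDER row NE9; filed by the NE9 crux-team (2) LEAF PROVER 02 lineage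
`b2b-balaban-t4-ne9-formalise-leaf-02` (gen 67); announced `[NE9LEAF02-G67-INTENT4]` («yours or mine, whoever is seated» — the OWNER's RECEIPT
`[NE9P1-G87-STAGED7]`; his `[NE9P1-G87-LANDED4]` invited the by-name form of §2).

WHY THIS FILE (cell context).  The OWNER's θ-letter `norm_form_defect_pi_le` is stated for ANY slot `Gp` modulo two DISPLAYED λ-letters
`‖Gp(R_k(D*_Uw))‖ ≤ C_λN₁(w)`, `‖D_U(Gp(R_k(D*_Uw)))‖ ≤ C_λ′N₁(w)`; this lineage's `exists_gaugeMode_letters_diagonal` inhabits both at print's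
`G′ := G′_k(U) = GpOfUk … a′ hpos′` on the diagonal class of Thm 3.11.  Plugging them in and packing the constant gives the ONE-LINE hypothesis `hθ` that
`B9Eq3130HessianSlotPerturbationDiagonal` ∕ `B9Eq3153FrakGkBoundSlotDiagonal` consume at print's slot (with `θ := θ̄·α ≤ γ₁∕2` a threshold on `α`).

WHAT IS PROVED (sorry-free; proof lane — no `def`, no `Prop` placeholder; [folklore] composition by name).
* **`exists_form_defect_pi_diagonal_closed`** — `∃ α₀ θ > 0` (`α₀ = min α₁ 1`, `θ = 2(abC + κC) + a²C² + κC² + 1` with `C` the λ-letter constant,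
  `a = 2M_φ′M_φ√#DirPair`, `b = 1 + 8√dM_φM_φ′`, `κ = 32dC_τM_φ²ρ_w`; closed in `(d, L, M_φ, M_φ′, a′, r, C_τ, ρ_w)`) such that for every `n`, `η`
  (`ηL^{n+1} = 1`), `c₀, c₁` (`c₀(L^{n+1})^d = c₁`, `|η|^d∕c₀ ≤ ρ_w`), `m`, background `U` with mutually adjoint transporters, `0 ≤ α ≤ α₀`, `U(b) ∈ U1`,
  `‖U(b) − 1‖ ≤ αη`, `‖U(∂p) − 1‖ ≤ αη²`, averaged windows `ε_j ≤ αr^j`, `Ū^j(b) ∈ U1`, ANY positivity witness `hpos′` of `Δ′_{a′,k}(U)`, and all bond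
  fields `u, v`: `‖⟨u, (π†∘Δ^η(U)∘π)v⟩ − ⟨u, Δ^η(U)v⟩‖ ≤ θ·α·N₁(u)·N₁(v)` with `π = 1 − D_U∘G′_k∘R_k∘D*_U` WRITTEN OUT (the OWNER's spelling).
* **`exists_form_defect_piOfUk_diagonal_closed`** — the same letter with `π` spelled `B9Eq3119DeltaPiTower.piOfUk L m n φ η U (GpOfUk … a′ hpos′)`, i.e.
  the left operator TOKEN-IDENTICAL with the `Δ₁`-slot of print's (3.122) `laplaceAkPi` (definitionally the first theorem).

HONEST.  [folklore] plumbing: `obtain` the λ-letters, `α₀ := min α₁ 1`, the OWNER's theorem at `Gp := GpOfUk …`, `θ`-weakening by `+1`.  Hypotheses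
DISPLAYED, not discharged: the windows (the plaquette window is NOT derived from the bond window), `hRS`, `ρ_w`, the trace letter `C_τ`, `hpos′` (ANY —
inhabited on the class by the site coercivity elsewhere), the E162 data.  Energy currency on the diagonal only — no Neumann series, no operator norm of
`Δ′_π`, no decay, NOT (3.131)'s `J`-form, NOT the (N)-reading; nothing of [B9] Thm 3.3 ∕ 3.10 ∕ 3.13 asserted.  NOT summit progress (cell pub-balaban: NE9
NOT PRINTED ∕ NOT PROVED; «NE9 ⇐ the named binders»; row WALLED ON A MODEL (O-NE9-1); spine PROVED 0∕9; rung (B)+1 finite T⁴ — NOT infinite volume,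
NOT mass gap, NOT BetaPertH, NOT Clay).
-/

noncomputable section

open scoped BigOperators InnerProductSpace ComplexConjugate

namespace Literature.MathematicalPhysics.QuantumFieldTheory.Balaban1983to89.B9Eq3120DeltaPiPrimeFormDiagonalClosed

open B4Sect5Torus (TSite)
open B9SectCLatticeCarrier (Bond DirPair)
open B7Prop1Explicit (U1)
open B11Eq103H1Complex (SiteL2K BondL2K covDerivL2K covDivL2K)
open B9Eq310HessianOperator (adTransportW hessOp covCurlL2K)
open B9Eq310DeltaPrime (plaqHolU)
open B9Eq315QTower (towerP UlevOf)
open B9Eq326OperatorTower (QprimeTowerW RofUk)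
open B9Eq324DeltaPrimeATower (laplacePrimeAk GpOfUk)
open B9Eq3120DeltaPiPrimeFormDiagonal (norm_form_defect_pi_le)
open B9Eq3119DeltaPiTower (piOfUk)
open B9Eq325GaugeModeLetterDiagonal (exists_gaugeMode_letters_diagonal)

variable {d : ℕ} (L : ℕ) [NeZero L]
  {𝔸 : Type*} [NormedRing 𝔸] [NormedAlgebra ℂ 𝔸] [CompleteSpace 𝔸] [NormOneClass 𝔸] [StarRing 𝔸] [NormedStarGroup 𝔸] [StarModule ℂ 𝔸]
  {W : Type*} [NormedAddCommGroup W] [InnerProductSpace ℂ W] [FiniteDimensional ℂ W] (φ : W ≃ₗ[ℂ] 𝔸)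
  {Mφ Mφ' : ℝ} (hMφ : 0 ≤ Mφ) (hMφ' : 0 ≤ Mφ') (hφ : ∀ w, ‖φ w‖ ≤ Mφ * ‖w‖) (hφ' : ∀ X, ‖φ.symm X‖ ≤ Mφ' * ‖X‖)
  {a' : ℝ} (ha' : 0 < a') {r : ℝ} (hr0 : 0 ≤ r) (hr1 : r < 1)
  (τ : 𝔸 →ₗ[ℂ] ℂ) {Cτ : ℝ} (hτ : ∀ X, ‖τ X‖ ≤ Cτ * ‖X‖) (hCτ : 0 ≤ Cτ) {ρw : ℝ} (hρw : 0 ≤ ρw)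

/-! ## §1 The θ-letter closed — `π_k(U)` written out (the OWNER's spelling) -/

include hMφ hMφ' hφ hφ' ha' hr0 hr1 hτ hCτ hρw in
/-- **THE θ-LETTER OF THE `Δ_π` PORT WITH THE `λ`-LETTERS INHABITED** (closing corollary of the OWNER's `norm_form_defect_pi_le` at `G′ := GpOfUk`):
`∃ α₀ θ > 0` before the diagonal binders such that `‖⟨u, (π_k†Δ^η(U)π_k)v⟩ − ⟨u, Δ^η(U)v⟩‖ ≤ θ·α·N₁(u)·N₁(v)` — the ONE displayed letter of
`B9Eq3130HessianSlotPerturbationDiagonal` for print's slot (3.122), modulo `hpos′` (ANY) only. [folklore]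
[cite: Balaban1985BackgroundPropagators, (3.119)–(3.120) p.419, (3.122) p.420, (3.36) p.396, Thm 3.11 p.416] -/
theorem exists_form_defect_pi_diagonal_closed :
    ∃ α₀ θ : ℝ, 0 < α₀ ∧ 0 < θ ∧ ∀ (n : ℕ) (η : ℝ), η * (L : ℝ) ^ (n + 1) = 1 →
      ∀ (c₀ c₁ : ℝ) [Fact (0 < c₀)] [Fact (0 < c₁)], c₀ * ((L : ℝ) ^ (n + 1)) ^ d = c₁ → |η| ^ d / c₀ ≤ ρw →
      ∀ (m : Fin d → ℕ) [∀ i, NeZero (m i)] (U : Bond d (towerP L m (n + 1)) → 𝔸ˣ),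
        (∀ (b : Bond d (towerP L m (n + 1))) (v u : W), ⟪adTransportW φ U b v, u⟫_ℂ = ⟪v, adTransportW φ (fun b => (U b)⁻¹) b u⟫_ℂ) →
      ∀ (α : ℝ), 0 ≤ α → α ≤ α₀ → (∀ b, U b ∈ U1 𝔸) → (∀ b, ‖(U b : 𝔸) - 1‖ ≤ α * η) →
        (∀ p : B9SectCLatticeCarrier.Plaq d (towerP L m (n + 1)), ‖(plaqHolU U p : 𝔸) - 1‖ ≤ α * η ^ 2) →
      ∀ (εU : ℕ → ℝ), (∀ j, 0 ≤ εU j) → (∀ j < n + 1, εU j ≤ α * r ^ j) →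
        (∀ (j : ℕ) (b : Bond d (towerP L m (j + 1))), ‖(UlevOf L m (n + 1) U j b : 𝔸) - 1‖ ≤ εU j) →
        (∀ (j : ℕ) (b : Bond d (towerP L m (j + 1))), UlevOf L m (n + 1) U j b ∈ U1 𝔸) →
      ∀ (hpos' : ∀ x : SiteL2K ℂ d (towerP L m (n + 1)) c₀ W, x ≠ 0 →
          0 < RCLike.re ⟪x, laplacePrimeAk L m n φ η U a' (c₁ := c₁) x⟫_ℂ)
        (u v : BondL2K ℂ d (towerP L m (n + 1)) c₀ W),
    ‖⟪u, (LinearMap.adjoint ((LinearMap.id : BondL2K ℂ d (towerP L m (n + 1)) c₀ W →ₗ[ℂ] BondL2K ℂ d (towerP L m (n + 1)) c₀ W) -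
            covDerivL2K ℂ c₀ ((η : ℂ))⁻¹ (adTransportW φ U) ∘ₗ GpOfUk L m n φ η U a' hpos' ∘ₗ RofUk L m n φ η U ∘ₗ covDivL2K ℂ c₀ ((η : ℂ))⁻¹ (adTransportW φ fun b => (U b)⁻¹)) ∘ₗ
          hessOp φ η U τ ∘ₗ
          ((LinearMap.id : BondL2K ℂ d (towerP L m (n + 1)) c₀ W →ₗ[ℂ] BondL2K ℂ d (towerP L m (n + 1)) c₀ W) -
            covDerivL2K ℂ c₀ ((η : ℂ))⁻¹ (adTransportW φ U) ∘ₗ GpOfUk L m n φ η U a' hpos' ∘ₗ RofUk L m n φ η U ∘ₗ covDivL2K ℂ c₀ ((η : ℂ))⁻¹ (adTransportW φ fun b => (U b)⁻¹))) v⟫_ℂ -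
        ⟪u, hessOp φ η U τ v⟫_ℂ‖ ≤
      θ * α *
        Real.sqrt (‖covCurlL2K ℂ c₀ ((η : ℂ))⁻¹ (adTransportW φ (fun _ : Bond d (towerP L m (n + 1)) => (1 : 𝔸ˣ))) u‖ ^ 2 +
          ‖covDivL2K ℂ c₀ ((η : ℂ))⁻¹ (adTransportW φ fun _ : Bond d (towerP L m (n + 1)) => (1 : 𝔸ˣ)⁻¹) u‖ ^ 2 + ‖u‖ ^ 2) *
        Real.sqrt (‖covCurlL2K ℂ c₀ ((η : ℂ))⁻¹ (adTransportW φ (fun _ : Bond d (towerP L m (n + 1)) => (1 : 𝔸ˣ))) v‖ ^ 2 +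
          ‖covDivL2K ℂ c₀ ((η : ℂ))⁻¹ (adTransportW φ fun _ : Bond d (towerP L m (n + 1)) => (1 : 𝔸ˣ)⁻¹) v‖ ^ 2 + ‖v‖ ^ 2) := by
  obtain ⟨α₁, C, hα₁, hC, HL⟩ := exists_gaugeMode_letters_diagonal L φ hMφ hMφ' hφ hφ' ha' hr0 hr1
  obtain ⟨θ, hθdef⟩ : ∃ θ : ℝ, θ =
      (2 * (2 * (Mφ' * Mφ) * Real.sqrt (Fintype.card (DirPair d)) * (1 + 8 * Real.sqrt d * (Mφ * Mφ')) * C + 32 * d * Cτ * Mφ ^ 2 * ρw * C) +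
        (2 * (Mφ' * Mφ) * Real.sqrt (Fintype.card (DirPair d))) ^ 2 * C ^ 2 + 32 * d * Cτ * Mφ ^ 2 * ρw * C ^ 2) + 1 := ⟨_, rfl⟩
  have hθ0 : 0 < θ := by rw [hθdef]; positivity
  refine ⟨min α₁ 1, θ, lt_min hα₁ one_pos, hθ0, ?_⟩
  intro n η hηL c₀ c₁ _ _ hw hρ m _ U hRS α hα0 hαle hUb hUη hpl εU hεU hεg hLε hLb hpos' u v
  have hα₁' : α ≤ α₁ := hαle.trans (min_le_left _ _)
  have hαone : α ≤ 1 := hαle.trans (min_le_right _ _)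
  have hLr : (0 : ℝ) < (L : ℝ) ^ (n + 1) := pow_pos (by exact_mod_cast Nat.pos_of_ne_zero (NeZero.ne L)) _
  have hη : η ≠ 0 := (pos_of_mul_pos_left (by rw [hηL]; exact one_pos) hLr.le).ne'
  have HLw := fun w => HL n η hηL c₀ c₁ hw m U hRS α hα0 hα₁' hUb hUη εU hεU hεg hLε hLb hpos' w
  have h := norm_form_defect_pi_le L m n φ hMφ hMφ' hφ hφ' τ hτ hCτ hη hρ U hRS hUb hα0 hαone hUη hpl
    (GpOfUk L m n φ η U a' hpos') hC.le hC.le (fun w => (HLw w).2.2.1) (fun w => (HLw w).2.2.2) u v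
  refine h.trans ?_
  have hN : 0 ≤ α *
          Real.sqrt (‖covCurlL2K ℂ c₀ ((η : ℂ))⁻¹ (adTransportW φ (fun _ : Bond d (towerP L m (n + 1)) => (1 : 𝔸ˣ))) u‖ ^ 2 +
            ‖covDivL2K ℂ c₀ ((η : ℂ))⁻¹ (adTransportW φ fun _ : Bond d (towerP L m (n + 1)) => (1 : 𝔸ˣ)⁻¹) u‖ ^ 2 + ‖u‖ ^ 2) *
          Real.sqrt (‖covCurlL2K ℂ c₀ ((η : ℂ))⁻¹ (adTransportW φ (fun _ : Bond d (towerP L m (n + 1)) => (1 : 𝔸ˣ))) v‖ ^ 2 +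
            ‖covDivL2K ℂ c₀ ((η : ℂ))⁻¹ (adTransportW φ fun _ : Bond d (towerP L m (n + 1)) => (1 : 𝔸ˣ)⁻¹) v‖ ^ 2 + ‖v‖ ^ 2) := by positivity
  have hle : (2 * (2 * (Mφ' * Mφ) * Real.sqrt (Fintype.card (DirPair d)) * (1 + 8 * Real.sqrt d * (Mφ * Mφ')) * C + 32 * d * Cτ * Mφ ^ 2 * ρw * C) +
        (2 * (Mφ' * Mφ) * Real.sqrt (Fintype.card (DirPair d))) ^ 2 * C ^ 2 + 32 * d * Cτ * Mφ ^ 2 * ρw * C ^ 2) ≤ θ := by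
    rw [hθdef]; linarith
  calc _ = (2 * (2 * (Mφ' * Mφ) * Real.sqrt (Fintype.card (DirPair d)) * (1 + 8 * Real.sqrt d * (Mφ * Mφ')) * C + 32 * d * Cτ * Mφ ^ 2 * ρw * C) +
        (2 * (Mφ' * Mφ) * Real.sqrt (Fintype.card (DirPair d))) ^ 2 * C ^ 2 + 32 * d * Cτ * Mφ ^ 2 * ρw * C ^ 2) * (α *
          Real.sqrt (‖covCurlL2K ℂ c₀ ((η : ℂ))⁻¹ (adTransportW φ (fun _ : Bond d (towerP L m (n + 1)) => (1 : 𝔸ˣ))) u‖ ^ 2 +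
            ‖covDivL2K ℂ c₀ ((η : ℂ))⁻¹ (adTransportW φ fun _ : Bond d (towerP L m (n + 1)) => (1 : 𝔸ˣ)⁻¹) u‖ ^ 2 + ‖u‖ ^ 2) *
          Real.sqrt (‖covCurlL2K ℂ c₀ ((η : ℂ))⁻¹ (adTransportW φ (fun _ : Bond d (towerP L m (n + 1)) => (1 : 𝔸ˣ))) v‖ ^ 2 +
            ‖covDivL2K ℂ c₀ ((η : ℂ))⁻¹ (adTransportW φ fun _ : Bond d (towerP L m (n + 1)) => (1 : 𝔸ˣ)⁻¹) v‖ ^ 2 + ‖v‖ ^ 2)) := by ring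
    _ ≤ θ * (α *
          Real.sqrt (‖covCurlL2K ℂ c₀ ((η : ℂ))⁻¹ (adTransportW φ (fun _ : Bond d (towerP L m (n + 1)) => (1 : 𝔸ˣ))) u‖ ^ 2 +
            ‖covDivL2K ℂ c₀ ((η : ℂ))⁻¹ (adTransportW φ fun _ : Bond d (towerP L m (n + 1)) => (1 : 𝔸ˣ)⁻¹) u‖ ^ 2 + ‖u‖ ^ 2) *
          Real.sqrt (‖covCurlL2K ℂ c₀ ((η : ℂ))⁻¹ (adTransportW φ (fun _ : Bond d (towerP L m (n + 1)) => (1 : 𝔸ˣ))) v‖ ^ 2 +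
            ‖covDivL2K ℂ c₀ ((η : ℂ))⁻¹ (adTransportW φ fun _ : Bond d (towerP L m (n + 1)) => (1 : 𝔸ˣ)⁻¹) v‖ ^ 2 + ‖v‖ ^ 2)) := mul_le_mul_of_nonneg_right hle hN
    _ = _ := by ring

/-! ## §2 The same letter at the `Δ₁`-slot of `laplaceAkPi` — `π_k(U)` by name -/

include hMφ hMφ' hφ hφ' ha' hr0 hr1 hτ hCτ hρw in
/-- **THE SAME θ-LETTER AT THE SLOT OF `B9Eq3119DeltaPiTower.laplaceAkPi` BY NAME**: `π` spelled `piOfUk L m n φ η U (GpOfUk L m n φ η U a′ hpos′)`, so the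
left-hand operator is TOKEN-IDENTICAL with the `Δ₁`-slot `adjoint (piOfUk …) ∘ₗ hessOp φ η U τ ∘ₗ piOfUk …` of print's (3.122) `laplaceAkPi` (tree text of
`B9Eq3119DeltaPiTower`, ll. 168–172) — the `hθ` input of `B9Eq3130HessianSlotPerturbationDiagonal.exists_hessian_slot_perturbation_diagonal` at that slot;
definitionally the previous theorem (`piOfUk` unfolds to the written-out `1 − D_U G′_k R_k D*_U`). [folklore]
[cite: Balaban1985BackgroundPropagators, (3.119) p.419, (3.122) p.420] -/
theorem exists_form_defect_piOfUk_diagonal_closed :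
    ∃ α₀ θ : ℝ, 0 < α₀ ∧ 0 < θ ∧ ∀ (n : ℕ) (η : ℝ), η * (L : ℝ) ^ (n + 1) = 1 →
      ∀ (c₀ c₁ : ℝ) [Fact (0 < c₀)] [Fact (0 < c₁)], c₀ * ((L : ℝ) ^ (n + 1)) ^ d = c₁ → |η| ^ d / c₀ ≤ ρw →
      ∀ (m : Fin d → ℕ) [∀ i, NeZero (m i)] (U : Bond d (towerP L m (n + 1)) → 𝔸ˣ),
        (∀ (b : Bond d (towerP L m (n + 1))) (v u : W), ⟪adTransportW φ U b v, u⟫_ℂ = ⟪v, adTransportW φ (fun b => (U b)⁻¹) b u⟫_ℂ) →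
      ∀ (α : ℝ), 0 ≤ α → α ≤ α₀ → (∀ b, U b ∈ U1 𝔸) → (∀ b, ‖(U b : 𝔸) - 1‖ ≤ α * η) →
        (∀ p : B9SectCLatticeCarrier.Plaq d (towerP L m (n + 1)), ‖(plaqHolU U p : 𝔸) - 1‖ ≤ α * η ^ 2) →
      ∀ (εU : ℕ → ℝ), (∀ j, 0 ≤ εU j) → (∀ j < n + 1, εU j ≤ α * r ^ j) →
        (∀ (j : ℕ) (b : Bond d (towerP L m (j + 1))), ‖(UlevOf L m (n + 1) U j b : 𝔸) - 1‖ ≤ εU j) →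
        (∀ (j : ℕ) (b : Bond d (towerP L m (j + 1))), UlevOf L m (n + 1) U j b ∈ U1 𝔸) →
      ∀ (hpos' : ∀ x : SiteL2K ℂ d (towerP L m (n + 1)) c₀ W, x ≠ 0 →
          0 < RCLike.re ⟪x, laplacePrimeAk L m n φ η U a' (c₁ := c₁) x⟫_ℂ)
        (u v : BondL2K ℂ d (towerP L m (n + 1)) c₀ W),
    ‖⟪u, (LinearMap.adjoint (piOfUk L m n φ η U (GpOfUk L m n φ η U a' hpos')) ∘ₗ hessOp φ η U τ ∘ₗ
          piOfUk L m n φ η U (GpOfUk L m n φ η U a' hpos')) v⟫_ℂ -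
        ⟪u, hessOp φ η U τ v⟫_ℂ‖ ≤
      θ * α *
        Real.sqrt (‖covCurlL2K ℂ c₀ ((η : ℂ))⁻¹ (adTransportW φ (fun _ : Bond d (towerP L m (n + 1)) => (1 : 𝔸ˣ))) u‖ ^ 2 +
          ‖covDivL2K ℂ c₀ ((η : ℂ))⁻¹ (adTransportW φ fun _ : Bond d (towerP L m (n + 1)) => (1 : 𝔸ˣ)⁻¹) u‖ ^ 2 + ‖u‖ ^ 2) *
        Real.sqrt (‖covCurlL2K ℂ c₀ ((η : ℂ))⁻¹ (adTransportW φ (fun _ : Bond d (towerP L m (n + 1)) => (1 : 𝔸ˣ))) v‖ ^ 2 +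
          ‖covDivL2K ℂ c₀ ((η : ℂ))⁻¹ (adTransportW φ fun _ : Bond d (towerP L m (n + 1)) => (1 : 𝔸ˣ)⁻¹) v‖ ^ 2 + ‖v‖ ^ 2) :=
  exists_form_defect_pi_diagonal_closed L φ hMφ hMφ' hφ hφ' ha' hr0 hr1 τ hτ hCτ hρw

end Literature.MathematicalPhysics.QuantumFieldTheory.Balaban1983to89.B9Eq3120DeltaPiPrimeFormDiagonalClosed

end
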